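import Mathlib
import HarnessLib
import Summits.HubbardSuperconductivity.HubbardSuperconductivity.Theorems.KLProgrammeKLRegimeEngineTwoLegStepV17F2ClosersSizes

/-!
# K3 gen 8, ENGINE child `KLRegimeEngineV17F2` (stmt-HubbardSuperconductivity-20437), stubs (e)/(M): the closer shells with the PACKAGE `(G, Q)` AND the
# thresholds as binders (plan g17 (R44) to r2d-p1: «make Q a binder too» — token #12 `klEngQ6 ↦ klEngQ7`, #7 `klEngGeo7`, #10 `klEngU₀9` all compose by one row each)

Cell gate-hubbard-kl, seat hubbard-kl-r2d-p1 (g5).  The frozen token set of the 20437 render is {V17F2 ×6, #7, #8, #10, #12} (KL STATUS plan g17 (R44)); instead of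
one literal twin per package/threshold identifier (p531478 `klEngQ6/klEngU₀6`, p532097 `klEngU₀7`, p532991 `_thr`), this file states the shells ONCE for an
ARBITRARY package `(G, Q)` carrying c4a-1's table (`klC4aJetC ≤ G.S`, `klC4aJetC' P R ≤ Q.S'`, `0 ≤ Q.CL β n`) and arbitrary doors `c₃ ≤ klEngC₃3 P R`,
`U₀c ≤ klEngU₀4 P R c` (+ `U₀c ≤ klE3U₀all R` in the size currency), with the stub's literal binder ORDER:

* `stub_twoLeg_step_of_residuals_GQ` — rows B1–B3 (fits) + C1–C2 ⇒ `TwoLegStepV17F2 L M G P Q R β U μ n`;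
* `stub_twoLeg_step_of_engineSizes_GQ` — rows B1′/B2′ (SIZES `Z·U²`, `S·U²` with `Z, S ≤ 2^{10|11}e¹⁸κ₀⁴·klE3Acum R`) + C1–C2 ⇒ the same (fits discharged by the
  all-scales door, `…V17F2ClosersSizes`);
* `stub_twoLeg_scale0_of_twoLegStepV17F_zero_GQ` — (M): the rev-1 text at `(G, Q)` ⇒ the rev-2 text (history vacuous at `n = 0`).

For the REGISTERED bytes `(G, Q) = (klEngGeo7, klEngQ7 P R)`, doors `(klEngC₃6 P R, klEngU₀9 P R c)`: pass `klC4aJetC_le_klEngGeo7_S`, the `Q7` row of c4a-1's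
`klC4aJetC'_le_klEngQ6_S'` (`(klEngQ7 P R).S' = (klEngQ6 P R).S'`, …DefsQ7), `(klEngQ7_wf P R).2.2.2.2.2.2.2`, `klEngC₃6_le_klEngC₃3`, `klEngU₀9_le_klEngU₀4`
(`klEngU₀9 ≤ klEngU₀8 ≤ klE3U₀all`).  Proofs only; nothing about the model is asserted; nothing asserts superconductivity.  [cite: BenfattoGiulianiMastropietro2006] (§2.4 (2.36)).
-/

noncomputable section

namespace Summit.HubbardSuperconductivity.HubbardSuperconductivity.Theorems.EngineV8

set_option linter.dupNamespace false -- summit = problem name (single-conjunct summit), D-0017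

open Real Finset Literature.MathematicalPhysics.QuantumLattice Literature.Probability.LatticeModels
open Literature.MathematicalPhysics.QuantumLattice.FermiRG Literature.MathematicalPhysics.QuantumLattice.BandSectorCounting
open Summit.HubbardSuperconductivity.HubbardSuperconductivity.Theorems.KLProgrammeLegKernels
open Summit.HubbardSuperconductivity.HubbardSuperconductivity.Theorems.DispersionFlow
open Summit.HubbardSuperconductivity.HubbardSuperconductivity.Theorems.PerturbedFermiCurve
open Summit.HubbardSuperconductivity.HubbardSuperconductivity.Theorems.KLRegimeSplit
open Summit.HubbardSuperconductivity.HubbardSuperconductivity.Theorems.TwoPointAssembly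

/-- **STUB (e) OF 20437 MODULO ITS NAMED RESIDUALS, package `(G, Q)` and thresholds `(c₃, U₀c)` as binders.**  Package rows: `hGS : klC4aJetC ≤ G.S`,
`hQS : klC4aJetC' P R ≤ Q.S'`, `hQCL : 0 ≤ Q.CL β n`; doors `c₃ ≤ klEngC₃3 P R`, `U₀c ≤ klEngU₀4 P R c`; then the stub's literal binders at `(G, Q)`, rows B1 `hz`,
B2 `hm₁'`, B3 `hfit1`, C1 `hcut`, C2 `hsp`. -/
theorem stub_twoLeg_step_of_residuals_GQ (G : GeoConsts) (Q : EngConsts) {c₃ U₀c : ℝ} (P : SplitConsts) (R : RenConsts) (c : ℝ)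
    (hGS : ∀ k, klC4aJetC k ≤ G.S k) (hQS : ∀ k, klC4aJetC' P R k ≤ Q.S' k) (hQCL : ∀ (β : ℝ) (n : ℕ), 0 ≤ Q.CL β n)
    (hc₃ : c₃ ≤ klEngC₃3 P R) (hU₀ : U₀c ≤ klEngU₀4 P R c) (hP : P.WF) (hR : R.WF2) (hc : 0 < c) (hc3 : c ≤ c₃)
    (μ : ℝ) (hμ : μ ∈ klWindowC) (U : ℝ) (hU : 0 < U) (hUle : U ≤ U₀c) (β : ℝ) (hβ : klBetaMin ≤ β) (hβc : β ≤ Real.exp (c / U ^ 2))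
    (L M : ℕ) [NeZero L] [NeZero M] (hL : klEngL₃ β U ≤ L) (hM : klEngM₃ β U L ≤ M)
    (n : ℕ) (hn1 : 1 ≤ n) (hn : n ≤ nScales β + 1) (hreg : IsKLRegime U c (-(n : ℤ)))
    (hhist : HistP klPredsV17F2 L M G P Q R β U μ 0 n)
    (hfr : FrameOK R U (nScales β) μ (klFlowFrameU L M β U μ n))
    (hE : EngineBoundsAtV17F2 L M G P Q β U μ n)
    (hJ : TwoLegReadJetBound L M klC4aJetC (klC4aJetC' P R) β U μ (klFlowFrameU L M β U μ n) n)
    (hz : ∀ k ∈ klShell L μ (klFlowFrameU L M β U μ n) n, |klFieldStrength L M β U μ (klFlowFrameU L M β U μ n) n k - 1| ≤ R.cz * |U|)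
    {m₁' : ℝ}
    (hm₁' : ∀ q : Momentum, |frameLevel μ (klFlowFrameU L M β U μ n) q| ≤ klScale klE0 n →
      ‖fderiv ℝ (evalM (symInterp L (fun p => klLocSelfEnergyRe L M β U μ (klFlowFrameU L M β U μ n) n p -
        (klFlowFrameU L M β U μ n).eval (latticeMomentum L p)))) q‖ ≤ m₁')
    (hfit1 : m₁' + 4 / 3 * R.Gfr 1 * U ^ 2 ≤ R.cz * |U| * (cDtmin (-1.2) (-0.05) / 2))
    (hcut : ∀ (Mq : ℕ → ℕ) (L₁ M₁ M₂ : ℕ) [NeZero L₁] [NeZero M₁] [NeZero M₂], L ≤ L₁ → Q.M0 β L₁ ≤ M₁ → Mq L₁ ≤ M₁ → M₁ ≤ M₂ →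
      (∀ j < n, histV17F2 L₁ M₁ G P Q R β U μ j ∧ TwoLegSlopes L₁ M₁ R β U μ (klFlowFrameU L₁ M₁ β U μ j) j) →
      (∀ j < n, histV17F2 L₁ M₂ G P Q R β U μ j ∧ TwoLegSlopes L₁ M₂ R β U μ (klFlowFrameU L₁ M₂ β U μ j) j) →
        ∀ θ : ℝ, |klLocalPart L₁ M₁ β U μ (klFlowFrameU L₁ M₁ β U μ n) n θ -
          klLocalPart L₁ M₂ β U μ (klFlowFrameU L₁ M₂ β U μ n) n θ| ≤ Q.CL β n / 4 / L₁)
    (hsp : ∀ (Mq : ℕ → ℕ) (L₁ L₂ M₂ : ℕ) [NeZero L₁] [NeZero L₂] [NeZero M₂], L ≤ L₁ → L₁ ∣ L₂ → Q.M0 β L₁ ≤ M₂ → Mq L₁ ≤ M₂ →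
      Q.M0 β L₂ ≤ M₂ → Mq L₂ ≤ M₂ →
      (∀ j < n, histV17F2 L₁ M₂ G P Q R β U μ j ∧ TwoLegSlopes L₁ M₂ R β U μ (klFlowFrameU L₁ M₂ β U μ j) j) →
      (∀ j < n, histV17F2 L₂ M₂ G P Q R β U μ j ∧ TwoLegSlopes L₂ M₂ R β U μ (klFlowFrameU L₂ M₂ β U μ j) j) →
        ∀ θ : ℝ, |klLocalPart L₁ M₂ β U μ (klFlowFrameU L₁ M₂ β U μ n) n θ -
          klLocalPart L₂ M₂ β U μ (klFlowFrameU L₂ M₂ β U μ n) n θ| ≤ Q.CL β n / 4 / L₁) :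
    TwoLegStepV17F2 L M G P Q R β U μ n := by
  have _ := hP; have _ := hM; have _ := hn1; have _ := hreg; have _ := hhist; have _ := hE
  exact twoLegStepV17F2_of_jets_sepTubeGradient_nestedLegs_pkg G Q P hR hc (hc3.trans hc₃) hμ hU (hUle.trans hU₀) hβ hβc hL hn hfr (hQCL β n)
    hGS hQS hJ.1 hJ.2 hz hm₁' hfit1 hcut hsp

/-- **STUB (e) OF 20437 MODULO ENGINE SIZES, package `(G, Q)` and thresholds as binders** (rows B1′ `hzZ`, B2′ `hmS` in the `Z·U²`, `S·U²` currency with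
`Z, S ≤ 2^{10|11}e¹⁸κ₀⁴·klE3Acum R`; the extra door `U₀c ≤ klE3U₀all R` is met by `klEngU₀8/9`). -/
theorem stub_twoLeg_step_of_engineSizes_GQ (G : GeoConsts) (Q : EngConsts) {c₃ U₀c : ℝ} (P : SplitConsts) (R : RenConsts) (c : ℝ)
    (hGS : ∀ k, klC4aJetC k ≤ G.S k) (hQS : ∀ k, klC4aJetC' P R k ≤ Q.S' k) (hQCL : ∀ (β : ℝ) (n : ℕ), 0 ≤ Q.CL β n)
    (hc₃ : c₃ ≤ klEngC₃3 P R) (hU₀ : U₀c ≤ klEngU₀4 P R c) (hU₀all : U₀c ≤ klE3U₀all R) (hP : P.WF) (hR : R.WF2) (hc : 0 < c) (hc3 : c ≤ c₃)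
    (μ : ℝ) (hμ : μ ∈ klWindowC) (U : ℝ) (hU : 0 < U) (hUle : U ≤ U₀c) (β : ℝ) (hβ : klBetaMin ≤ β) (hβc : β ≤ Real.exp (c / U ^ 2))
    (L M : ℕ) [NeZero L] [NeZero M] (hL : klEngL₃ β U ≤ L) (hM : klEngM₃ β U L ≤ M)
    (n : ℕ) (hn1 : 1 ≤ n) (hn : n ≤ nScales β + 1) (hreg : IsKLRegime U c (-(n : ℤ)))
    (hhist : HistP klPredsV17F2 L M G P Q R β U μ 0 n)
    (hfr : FrameOK R U (nScales β) μ (klFlowFrameU L M β U μ n))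
    (hE : EngineBoundsAtV17F2 L M G P Q β U μ n)
    (hJ : TwoLegReadJetBound L M klC4aJetC (klC4aJetC' P R) β U μ (klFlowFrameU L M β U μ n) n)
    {Z S : ℝ} (hZ : Z ≤ (2 : ℝ) ^ 10 * Real.exp 1 ^ 18 * Real.sqrt (2 * (7 + 1606732)) ^ 4 * klE3Acum R)
    (hS : S ≤ (2 : ℝ) ^ 11 * Real.exp 1 ^ 18 * Real.sqrt (2 * (7 + 1606732)) ^ 4 * klE3Acum R)
    (hzZ : ∀ k ∈ klShell L μ (klFlowFrameU L M β U μ n) n, |klFieldStrength L M β U μ (klFlowFrameU L M β U μ n) n k - 1| ≤ Z * U ^ 2)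
    (hmS : ∀ q : Momentum, |frameLevel μ (klFlowFrameU L M β U μ n) q| ≤ klScale klE0 n →
      ‖fderiv ℝ (evalM (symInterp L (fun p => klLocSelfEnergyRe L M β U μ (klFlowFrameU L M β U μ n) n p -
        (klFlowFrameU L M β U μ n).eval (latticeMomentum L p)))) q‖ ≤ S * U ^ 2)
    (hcut : ∀ (Mq : ℕ → ℕ) (L₁ M₁ M₂ : ℕ) [NeZero L₁] [NeZero M₁] [NeZero M₂], L ≤ L₁ → Q.M0 β L₁ ≤ M₁ → Mq L₁ ≤ M₁ → M₁ ≤ M₂ →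
      (∀ j < n, histV17F2 L₁ M₁ G P Q R β U μ j ∧ TwoLegSlopes L₁ M₁ R β U μ (klFlowFrameU L₁ M₁ β U μ j) j) →
      (∀ j < n, histV17F2 L₁ M₂ G P Q R β U μ j ∧ TwoLegSlopes L₁ M₂ R β U μ (klFlowFrameU L₁ M₂ β U μ j) j) →
        ∀ θ : ℝ, |klLocalPart L₁ M₁ β U μ (klFlowFrameU L₁ M₁ β U μ n) n θ -
          klLocalPart L₁ M₂ β U μ (klFlowFrameU L₁ M₂ β U μ n) n θ| ≤ Q.CL β n / 4 / L₁)
    (hsp : ∀ (Mq : ℕ → ℕ) (L₁ L₂ M₂ : ℕ) [NeZero L₁] [NeZero L₂] [NeZero M₂], L ≤ L₁ → L₁ ∣ L₂ → Q.M0 β L₁ ≤ M₂ → Mq L₁ ≤ M₂ →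
      Q.M0 β L₂ ≤ M₂ → Mq L₂ ≤ M₂ →
      (∀ j < n, histV17F2 L₁ M₂ G P Q R β U μ j ∧ TwoLegSlopes L₁ M₂ R β U μ (klFlowFrameU L₁ M₂ β U μ j) j) →
      (∀ j < n, histV17F2 L₂ M₂ G P Q R β U μ j ∧ TwoLegSlopes L₂ M₂ R β U μ (klFlowFrameU L₂ M₂ β U μ j) j) →
        ∀ θ : ℝ, |klLocalPart L₁ M₂ β U μ (klFlowFrameU L₁ M₂ β U μ n) n θ -
          klLocalPart L₂ M₂ β U μ (klFlowFrameU L₂ M₂ β U μ n) n θ| ≤ Q.CL β n / 4 / L₁) :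
    TwoLegStepV17F2 L M G P Q R β U μ n := by
  have _ := hP; have _ := hM; have _ := hn1; have _ := hreg; have _ := hhist; have _ := hE
  have hUall : U ≤ klE3U₀all R := hUle.trans hU₀all
  exact twoLegStepV17F2_of_jets_sepTubeGradient_nestedLegs_pkg G Q P hR hc (hc3.trans hc₃) hμ hU (hUle.trans hU₀) hβ hβc hL hn hfr (hQCL β n)
    hGS hQS hJ.1 hJ.2 (fun k hk => fieldStrength_fit_of_size hR.2.2 hU hUall hZ (hzZ k hk)) hmS (slope_fit_of_size hR.2.2 hU hUall hS) hcut hsp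

/-- **STUB (M) OF 20437 FROM THE REV-1 TEXT, package `(G, Q)` and thresholds as binders**: the stub's literal binders + `TwoLegStepV17F L M G P Q R β U μ 0`
(e.g. p1b's bare-frame assembly at `(G, Q)`) ⇒ `TwoLegStepV17F2 L M G P Q R β U μ 0`. -/
theorem stub_twoLeg_scale0_of_twoLegStepV17F_zero_GQ (G : GeoConsts) (Q : EngConsts) {c₃ U₀c : ℝ} (P : SplitConsts) (R : RenConsts) (c : ℝ)
    (hP : P.WF) (hR : R.WF2) (hc : 0 < c) (hc3 : c ≤ c₃) (μ : ℝ) (hμ : μ ∈ klWindowC) (U : ℝ) (hU : 0 < U) (hUle : U ≤ U₀c) (β : ℝ)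
    (hβ : klBetaMin ≤ β) (hβc : β ≤ Real.exp (c / U ^ 2)) (L M : ℕ) [NeZero L] [NeZero M] (hL : klEngL₃ β U ≤ L) (hM : klEngM₃ β U L ≤ M)
    (hfr : FrameOK R U (nScales β) μ (klFlowFrameU L M β U μ 0))
    (hE : EngineBoundsAtV17F2 L M G P Q β U μ 0)
    (hJ : TwoLegReadJetBound L M klC4aJetC (klC4aJetC' P R) β U μ (klFlowFrameU L M β U μ 0) 0)
    (h : TwoLegStepV17F L M G P Q R β U μ 0) :
    TwoLegStepV17F2 L M G P Q R β U μ 0 := by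
  have _ := hP; have _ := hR; have _ := hc; have _ := hc3; have _ := hμ; have _ := hU; have _ := hUle; have _ := hβ; have _ := hβc
  have _ := hL; have _ := hM; have _ := hfr; have _ := hE; have _ := hJ
  exact (twoLegStepV17F2_zero_iff_V17F_zero G P Q R β U μ).2 h

end Summit.HubbardSuperconductivity.HubbardSuperconductivity.Theorems.EngineV8

end
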